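import Summits.KontsevichZagierPeriods.KontsevichZagierPeriods.Theorems.RootDecompWalshStrataConicSectionK0
import Summits.KontsevichZagierPeriods.KontsevichZagierPeriods.Theorems.RootDecompWalshStrataSectorWalls02

/-!
# Root decomposition & Walsh strata — E-type sectors with LINE AND CONIC walls (gen 8, §39)

Route `RootDecompWalshStrata`, leaf `QuadricBakerDescent` (stmt-27597), residual R-E2 (NODE.md, decomp-kz-lens-4).
`InBaker.of_psector_cwalls`: the sector theorem `InBaker.of_psector_walls` (SectorWalls02) with the wall list
enlarged by finitely many ADAPTED CONIC WALLS `a(κ₀X² + κ₁Y²) + c = (q₀ + q₁X + q₂Y)²` (only the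
degenerate horizontal pair `aκ₀ = q₁²`, `q₀ = q₂ = 0` is excluded; `c < 0`, or — v11, sign-free — `κ₁ > 0`,
every conic wall off the centre (`q₀² ≠ c`) and with no double-root radicand).  A boundary section on such a wall goes to
`InBaker.psection_conic` (§37) when `k = aκ₀ − q₁² ≠ 0` and its radicand `δ` is non-zero, to the line
instruments (`InBaker.psection_line` / a null vertical wall) when `δ ≡ 0` — then the wall is the rational line
`kX = q₁(q₀ + q₂Y)` —, and to `InBaker.psection_conic_k0` (§38, rational branch) when `k = 0`
(`InBaker.psection_cwall`).
[KontsevichZagier2001 §1.2 rules (1)–(3); BCR1998 §2.2; this node]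
-/

noncomputable section

open Set MeasureTheory MvPolynomial Literature.NumberTheory.Transcendental
open Literature.ModelTheory.ExponentialFields (IsSemialgebraic IsSemialgebraic)

namespace Summit.KontsevichZagierPeriods.RootDecompWalshStrata.ConicDescent.BallCube

variable {κ₀ κ₁ : ℚ}

/-- Auxiliary step `snoc2_zero'''`. [bookkeeping] -/
private theorem snoc2_zero''' (x : Fin 1 → ℝ) (t : ℝ) : (Fin.snoc x t : Fin 2 → ℝ) 0 = x 0 := rfl
/-- Auxiliary step `snoc2_one'''`. [bookkeeping] -/
private theorem snoc2_one''' (x : Fin 1 → ℝ) (t : ℝ) : (Fin.snoc x t : Fin 2 → ℝ) 1 = t := rfl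

/-! #### 39.1 The adapted conic wall with a given linear form -/

/-- The adapted conic wall `a(κ₀X² + κ₁Y²) + c = (q₀ + q₁X + q₂Y)²` as a `ConicWall`. -/
def cwall (κ₀ κ₁ a c : ℚ) (q : Wall) : ConicWall := ⟨κ₀, κ₁, a, c, q.k0, q.k1, q.k2⟩

/-- Auxiliary step `cwall_κ₀`. [bookkeeping] -/
@[simp] theorem cwall_κ₀ (a c : ℚ) (q : Wall) : (cwall κ₀ κ₁ a c q).κ₀ = κ₀ := rfl
/-- Auxiliary step `cwall_κ₁`. [bookkeeping] -/
@[simp] theorem cwall_κ₁ (a c : ℚ) (q : Wall) : (cwall κ₀ κ₁ a c q).κ₁ = κ₁ := rfl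
/-- Auxiliary step `cwall_a`. [bookkeeping] -/
@[simp] theorem cwall_a (a c : ℚ) (q : Wall) : (cwall κ₀ κ₁ a c q).a = a := rfl
/-- Auxiliary step `cwall_c`. [bookkeeping] -/
@[simp] theorem cwall_c (a c : ℚ) (q : Wall) : (cwall κ₀ κ₁ a c q).c = c := rfl
/-- Auxiliary step `cwall_l₀`. [bookkeeping] -/
@[simp] theorem cwall_l₀ (a c : ℚ) (q : Wall) : (cwall κ₀ κ₁ a c q).l₀ = q.k0 := rfl
/-- Auxiliary step `cwall_l₁`. [bookkeeping] -/
@[simp] theorem cwall_l₁ (a c : ℚ) (q : Wall) : (cwall κ₀ κ₁ a c q).l₁ = q.k1 := rfl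
/-- Auxiliary step `cwall_l₂`. [bookkeeping] -/
@[simp] theorem cwall_l₂ (a c : ℚ) (q : Wall) : (cwall κ₀ κ₁ a c q).l₂ = q.k2 := rfl
/-- Auxiliary step `cwall_k`. [bookkeeping] -/
@[simp] theorem cwall_k (a c : ℚ) (q : Wall) : (cwall κ₀ κ₁ a c q).k = a * κ₀ - q.k1 ^ 2 := rfl

/-! #### 39.2 A section on an adapted conic wall, all strata -/

/-- **CONIC-WALL SECTION, EVERY STRATUM.**  `k = 0` (and `L ≢ 0`): `InBaker.psection_conic_k0`; `k ≠ 0`: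
`InBaker.psection_conic` when the radicand `δ` is non-zero; when `δ ≡ 0` the wall points satisfy the rational
LINE `kX = q₁(q₀ + q₂Y)`, i.e. `ζ(k − q₁q₂t) = q₁q₀N(t)`: `InBaker.psection_line` if `q₁q₀ ≠ 0`, else a
null vertical wall. [this node] -/
theorem InBaker.psection_cwall (hκ : 0 < κ₀ ∧ 0 ≤ κ₁) (γ a c : ℚ) (ha : a ≠ 0) (q : Wall)
    (hc : c < 0 ∨ (0 < κ₁ ∧ q.k0 ^ 2 ≠ c ∧ ((cwall κ₀ κ₁ a c q).δe ≠ 0 →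
      (cwall κ₀ κ₁ a c q).δg - (cwall κ₀ κ₁ a c q).δf ^ 2 / (4 * (cwall κ₀ κ₁ a c q).δe) ≠ 0)))
    (hk : a * κ₀ - q.k1 ^ 2 ≠ 0 ∨ q.k0 ≠ 0 ∨ q.k2 ≠ 0) {S : Set (Fin 1 → ℝ)} (ζ : (Fin 1 → ℝ) → ℝ)
    (hζsa : IsSemialgebraicFunOn ℚ S ζ) (hS01 : ∀ x ∈ S, 0 ≤ x 0 ∧ x 0 ≤ 1)
    (hζ : ∀ x ∈ S, 0 < ζ x ∧ ζ x ^ 2 ≤ 1)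
    (hwall : ∀ x ∈ S, (a : ℝ) * ζ x ^ 2 + c =
      (q.k0 + (q.k1 + q.k2 * x 0) * (ζ x / pN κ₀ κ₁ (x 0))) ^ 2)
    (r₁ : KZ.IntegralRep 1) (hr₁ : r₁.domain ⊆ S)
    (hint : EqOn r₁.integrand (fun x => ppot κ₀ κ₁ γ a c (Fin.snoc x (ζ x))) r₁.domain) :
    InBaker (KZ.of r₁) := by
  rcases eq_or_ne (a * κ₀ - q.k1 ^ 2) 0 with hk0 | hkne
  · -- `k = 0`: the rational branch
    exact InBaker.psection_conic_k0 (cwall κ₀ κ₁ a c q) hκ γ ha hk0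
      (hk.resolve_left (not_not.2 hk0)) ζ hζsa hS01 hζ hwall r₁ hr₁ hint
  have hWk : (cwall κ₀ κ₁ a c q).k ≠ 0 := by rw [cwall_k]; exact hkne
  by_cases hnd : (cwall κ₀ κ₁ a c q).δe ≠ 0 ∨ (cwall κ₀ κ₁ a c q).δf ≠ 0 ∨ (cwall κ₀ κ₁ a c q).δg ≠ 0
  · exact InBaker.psection_conic (cwall κ₀ κ₁ a c q) hκ γ ha hc hWk hnd ζ hζsa hS01 hζ hwall r₁
      hr₁ hint
  -- `δ ≡ 0`: the wall is the rational line `kX = q₁(q₀ + q₂Y)`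
  have hnd' : (cwall κ₀ κ₁ a c q).δe = 0 ∧ (cwall κ₀ κ₁ a c q).δf = 0 ∧ (cwall κ₀ κ₁ a c q).δg = 0 := by
    by_contra h
    exact hnd (by tauto)
  obtain ⟨he, hf, hg⟩ := hnd'
  have hline : ∀ x ∈ S, ζ x * (((a * κ₀ - q.k1 ^ 2 : ℚ) : ℝ) + ((-(q.k1 * q.k2) : ℚ) : ℝ) * x 0) =
      -((-(q.k1 * q.k0) : ℚ) : ℝ) * pN κ₀ κ₁ (x 0) := by
    intro x hx
    have hN := pN_pos hκ (x 0)
    have hsq : secE (cwall κ₀ κ₁ a c q) ζ x ^ 2 =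
        (cwall κ₀ κ₁ a c q).δ (secX κ₀ κ₁ ζ x * x 0) := by
      refine (cwall κ₀ κ₁ a c q).sq_of_wall (secX κ₀ κ₁ ζ x) (secX κ₀ κ₁ ζ x * x 0) ?_
      rw [cwall_κ₀, cwall_κ₁, cwall_a, cwall_c, cwall_l₀, cwall_l₁, cwall_l₂, norm_secX hκ ζ x,
        hwall x hx, secX]
      ring
    rw [(cwall κ₀ κ₁ a c q).δ_eq_qD, he, hf, hg, qD] at hsq
    have h0 : secE (cwall κ₀ κ₁ a c q) ζ x = 0 := by
      have h' : secE (cwall κ₀ κ₁ a c q) ζ x ^ 2 = 0 := by rw [hsq]; push_cast; ring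
      exact pow_eq_zero_iff (two_ne_zero) |>.1 h'
    simp only [secE, secX, ConicWall.L, cwall_κ₀, cwall_κ₁, cwall_k, cwall_l₀, cwall_l₁,
      cwall_l₂] at h0
    push_cast at h0 ⊢
    have h1 : ((a : ℝ) * κ₀ - q.k1 ^ 2) * ζ x -
        q.k1 * (q.k0 * pN κ₀ κ₁ (x 0) + q.k2 * (ζ x * x 0)) = 0 := by
      have h2 := congrArg (· * pN κ₀ κ₁ (x 0)) h0
      simp only [zero_mul] at h2
      rw [← h2]
      field_simp
    linear_combination h1
  by_cases hk0 : q.k1 * q.k0 = 0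
  · -- through the centre: the null vertical wall `k − q₁q₂t = 0`
    refine InBaker.of_subset_zeroSet r₁
      (MvPolynomial.C (a * κ₀ - q.k1 ^ 2) + MvPolynomial.C (-(q.k1 * q.k2)) * X 0 :
        MvPolynomial (Fin 1) ℚ) ⟨fun _ => 0, ?_⟩ fun v hv => ?_
    · simp only [map_add, map_mul, map_neg, MvPolynomial.aeval_C, MvPolynomial.aeval_X,
        eq_ratCast, mul_zero, add_zero]
      exact_mod_cast hkne
    · have h := hline v (hr₁ hv)
      rw [hk0, neg_zero, Rat.cast_zero, neg_zero, zero_mul, mul_eq_zero] at h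
      rcases h with h | h
      · exact absurd h (hζ v (hr₁ hv)).1.ne'
      · simp only [map_add, map_mul, MvPolynomial.aeval_C, MvPolynomial.aeval_X, eq_ratCast]
        exact h
  · exact InBaker.psection_line hκ γ a c ha (-(q.k1 * q.k0)) (a * κ₀ - q.k1 ^ 2)
      (-(q.k1 * q.k2)) (neg_ne_zero.2 hk0) ζ hS01 hζ hline r₁ hr₁ hint

/-! #### 39.3 The sector theorem with line and conic walls -/

/-- **E-TYPE SECTOR PIECE WITH LINE AND ADAPTED CONIC WALLS.**  `[T, γ√(a(κ₀X² + κ₁Y²) + c)] ∈ InBaker`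
for an open piece `T` of the normalised sector whose boundary off the axis `X = 0` (inside a
closed `C` within the closed sector) lies on the conic `a(κ₀X² + κ₁Y²) + c = 0`, on finitely many rational
lines `ℓ i` (those through the centre genuine) and on finitely many adapted conic walls
`a(κ₀X² + κ₁Y²) + c = (q j)(X, Y)²` (not the degenerate horizontal pair `aκ₀ = q₁², q₀ = q₂ = 0`).  Proof: `InBaker.of_psector` + the cover of
every boundary section by the pulled-back walls; the new pieces go to `InBaker.psection_cwall`.
[KontsevichZagier2001 §1.2 rules (1)–(3); BCR1998 §2.2; this node] -/
theorem InBaker.of_psector_cwalls (hκ : 0 < κ₀ ∧ 0 ≤ κ₁) (γ a c : ℚ) (ha : a ≠ 0)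
    {n m : ℕ} (ℓ : Fin n → Wall) (hℓ0 : ∀ i, (ℓ i).k0 = 0 → (ℓ i).k1 ≠ 0 ∨ (ℓ i).k2 ≠ 0)
    (q : Fin m → Wall) (hq : ∀ j, a * κ₀ - (q j).k1 ^ 2 ≠ 0 ∨ (q j).k0 ≠ 0 ∨ (q j).k2 ≠ 0)
    (hc : c < 0 ∨ (0 < κ₁ ∧ ∀ j, (q j).k0 ^ 2 ≠ c ∧ ((cwall κ₀ κ₁ a c (q j)).δe ≠ 0 →
      (cwall κ₀ κ₁ a c (q j)).δg - (cwall κ₀ κ₁ a c (q j)).δf ^ 2 / (4 * (cwall κ₀ κ₁ a c (q j)).δe) ≠ 0)))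
    (σ : KZ.IntegralRep 2) (hσo : IsOpen σ.domain)
    (hσT : σ.domain ⊆ {w | 0 < w 1 ∧ w 1 < w 0 ∧ (κ₀ : ℝ) * w 0 ^ 2 + κ₁ * w 1 ^ 2 < 1})
    (hD : ∀ w ∈ σ.domain, 0 < (a : ℝ) * (κ₀ * w 0 ^ 2 + κ₁ * w 1 ^ 2) + c)
    (hσi : ∀ w ∈ σ.domain, σ.integrand w = ellW κ₀ κ₁ γ a c w)
    {C : Set (Fin 2 → ℝ)} (hC : IsClosed C) (hσC : σ.domain ⊆ C)
    (hCsec : ∀ w ∈ C, 0 ≤ w 1 ∧ w 1 ≤ w 0 ∧ (κ₀ : ℝ) * w 0 ^ 2 + κ₁ * w 1 ^ 2 ≤ 1)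
    (hwall : ∀ w ∈ C, w ∉ σ.domain → 0 < w 0 →
      (a : ℝ) * (κ₀ * w 0 ^ 2 + κ₁ * w 1 ^ 2) + c = 0 ∨ (∃ i, (ℓ i).eval (w 0) (w 1) = 0) ∨
        ∃ j, (a : ℝ) * (κ₀ * w 0 ^ 2 + κ₁ * w 1 ^ 2) + c = ((q j).eval (w 0) (w 1)) ^ 2) :
    InBaker (KZ.of σ) := by
  classical
  have hκ0 : (0 : ℝ) < κ₀ := by exact_mod_cast hκ.1
  have hκ1 : (0 : ℝ) ≤ κ₁ := by exact_mod_cast hκ.2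
  have ha' : (a : ℝ) ≠ 0 := by exact_mod_cast ha
  refine InBaker.of_psector hκ γ a c ha σ hσo hσT hD (fun w hw => by rw [hσi w hw, ellW])
    fun S ζ hS hζ _ hfr r₁ hr₁ hr₁i => ?_
  -- what a section point looks like
  have hF : ∀ x ∈ S, 0 ≤ ζ x ∧ (0 < ζ x → (0 ≤ x 0 ∧ x 0 ≤ 1) ∧ ζ x ^ 2 ≤ 1 ∧
      ((a : ℝ) * ζ x ^ 2 + c = 0 ∨
        (∃ i, ζ x * ((ℓ i).k1 + (ℓ i).k2 * x 0) = -(ℓ i).k0 * pN κ₀ κ₁ (x 0)) ∨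
        ∃ j, (a : ℝ) * ζ x ^ 2 + c =
          ((q j).k0 + ((q j).k1 + (q j).k2 * x 0) * (ζ x / pN κ₀ κ₁ (x 0))) ^ 2)) := fun x hx => by
    obtain ⟨h0, h⟩ := psector_frontier_facts hκ hσo hC hσC hCsec (hfr x hx)
    refine ⟨h0, fun hz => ?_⟩
    obtain ⟨ht, hz1, w, hwC, hwT, hX, hY, hsq, hXN⟩ := h hz
    refine ⟨ht, hz1, ?_⟩
    have hN := pN_pos hκ (x 0)
    rcases hwall w hwC hwT hX with hDw | ⟨i, hi⟩ | ⟨j, hj⟩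
    · left
      rw [← hsq]
      linarith
    · right; left
      refine ⟨i, ?_⟩
      rw [Wall.eval, hY] at hi
      rw [← hXN]
      linear_combination (pN κ₀ κ₁ (x 0)) * hi
    · right; right
      refine ⟨j, ?_⟩
      rw [Wall.eval, hsq, hY] at hj
      have hw0 : w 0 = ζ x / pN κ₀ κ₁ (x 0) := by rw [← hXN]; field_simp
      rw [hj, hw0]
      ring
  -- the cover of `S` by the pulled-back walls
  have hz0 : IsSemialgebraicFunOn ℚ S fun _ => (0 : ℝ) :=
    (isSemialgebraicFunOn_ratCast hS 0).congr fun _ _ => by simp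
  have hN : IsSemialgebraicFunOn ℚ S fun x => pN κ₀ κ₁ (x 0) :=
    (IsSemialgebraicFunOn.sqrt_holds (isSemialgebraicFunOn_aeval hS
      (MvPolynomial.C κ₀ + MvPolynomial.C κ₁ * X 0 ^ 2 : MvPolynomial (Fin 1) ℚ))).congr
      fun x _ => by simp [pN, pW]
  have hQ : IsSemialgebraicFunOn ℚ S fun x => (a : ℝ) * ζ x ^ 2 + c :=
    (((isSemialgebraicFunOn_ratCast hS a).mul_holds (hζ.mul_holds hζ)).add_holds
      (isSemialgebraicFunOn_ratCast hS c)).congr fun x _ => by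
        simp only [Pi.add_apply, Pi.mul_apply]; ring
  have hPc : IsSemialgebraic ℚ {x | x ∈ S ∧ ζ x = 0} := isSemialgebraic_sep_eq hζ hz0
  have hPq : IsSemialgebraic ℚ {x | x ∈ S ∧ (a : ℝ) * ζ x ^ 2 + c = 0} :=
    isSemialgebraic_sep_eq hQ hz0
  have hPl : ∀ i, IsSemialgebraic ℚ ({x | x ∈ S ∧
      ζ x * ((ℓ i).k1 + (ℓ i).k2 * x 0) = -(ℓ i).k0 * pN κ₀ κ₁ (x 0)} \ {x | x ∈ S ∧ ζ x = 0}) :=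
    fun i => (isSemialgebraic_sep_eq
      ((hζ.mul_holds (isSemialgebraicFunOn_aeval hS
        (MvPolynomial.C (ℓ i).k1 + MvPolynomial.C (ℓ i).k2 * X 0 :
          MvPolynomial (Fin 1) ℚ))).congr fun x _ => by
          simp only [Pi.mul_apply, map_add, map_mul, MvPolynomial.aeval_C, MvPolynomial.aeval_X,
            eq_ratCast])
      (((isSemialgebraicFunOn_ratCast hS (-(ℓ i).k0)).mul_holds hN).congr fun x _ => by
          simp only [Pi.mul_apply]; push_cast; ring)).diff hPc
  have hPw : ∀ j, IsSemialgebraic ℚ ({x | x ∈ S ∧ (a : ℝ) * ζ x ^ 2 + c =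
      ((q j).k0 + ((q j).k1 + (q j).k2 * x 0) * (ζ x / pN κ₀ κ₁ (x 0))) ^ 2} \
        {x | x ∈ S ∧ ζ x = 0}) := fun j => by
    have hlin : IsSemialgebraicFunOn ℚ S fun x =>
        ((q j).k0 : ℝ) + ((q j).k1 + (q j).k2 * x 0) * (ζ x / pN κ₀ κ₁ (x 0)) :=
      ((isSemialgebraicFunOn_ratCast hS (q j).k0).add_holds ((isSemialgebraicFunOn_aeval hS
        (MvPolynomial.C (q j).k1 + MvPolynomial.C (q j).k2 * X 0 : MvPolynomial (Fin 1) ℚ)).mul_holds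
        (hζ.div hN fun x _ => (pN_pos hκ (x 0)).ne'))).congr fun x _ => by
          simp only [Pi.add_apply, Pi.mul_apply, map_add, map_mul, MvPolynomial.aeval_C,
            MvPolynomial.aeval_X, eq_ratCast]
    exact (isSemialgebraic_sep_eq hQ (hlin.mul_holds hlin |>.congr fun x _ => by
      simp only [Pi.mul_apply]; ring)).diff hPc
  have hSr : r₁.domain ⊆ S := hr₁.le
  refine InBaker.of_cover' r₁
    (fun o : Option (Option (Fin n ⊕ Fin m)) => match o with
      | none => {x | x ∈ S ∧ ζ x = 0}
      | some none => {x | x ∈ S ∧ (a : ℝ) * ζ x ^ 2 + c = 0}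
      | some (some (Sum.inl i)) => {x | x ∈ S ∧
          ζ x * ((ℓ i).k1 + (ℓ i).k2 * x 0) = -(ℓ i).k0 * pN κ₀ κ₁ (x 0)} \ {x | x ∈ S ∧ ζ x = 0}
      | some (some (Sum.inr j)) => {x | x ∈ S ∧ (a : ℝ) * ζ x ^ 2 + c =
          ((q j).k0 + ((q j).k1 + (q j).k2 * x 0) * (ζ x / pN κ₀ κ₁ (x 0))) ^ 2} \
            {x | x ∈ S ∧ ζ x = 0})
    (fun o => ?_) (fun x hx => ?_) fun o T hT hTr hTA => ?_
  · rcases o with _ | ⟨_ | ⟨i | j⟩⟩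
    · exact hPc
    · exact hPq
    · exact hPl i
    · exact hPw j
  · have hxS : x ∈ S := hSr hx
    obtain ⟨h0, h⟩ := hF x hxS
    rcases h0.eq_or_lt with hz | hz
    · exact mem_iUnion.2 ⟨none, hxS, hz.symm⟩
    · obtain ⟨-, -, hq' | ⟨i, hi⟩ | ⟨j, hj⟩⟩ := h hz
      · exact mem_iUnion.2 ⟨some none, hxS, hq'⟩
      · exact mem_iUnion.2 ⟨some (some (Sum.inl i)), ⟨hxS, hi⟩, fun h' => hz.ne' h'.2⟩
      · exact mem_iUnion.2 ⟨some (some (Sum.inr j)), ⟨hxS, hj⟩, fun h' => hz.ne' h'.2⟩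
  · have hTS : T ⊆ S := fun v hv => hSr (hTr hv)
    rcases o with _ | ⟨_ | ⟨i | j⟩⟩
    · -- the centre segment `r = 0`: `P(t, 0) = (γ c√c/(3a))/W(t)`
      have hTz : ∀ v ∈ T, ζ v = 0 := fun v hv => (hTA hv).2
      have hc0 : (a : ℝ) * 0 ^ 2 + c = c := by ring
      by_cases hcp : 0 < c
      · refine InBaker.sqrt_const_even c hcp (Polynomial.C (γ * c / (3 * a)))
          (Polynomial.C κ₀ + Polynomial.C κ₁ * Polynomial.X) _ (fun v _ => ?_) fun v hv => ?_
        · have h3 : (0 : ℝ) < κ₀ + κ₁ * v 0 ^ 2 := by nlinarith [mul_nonneg hκ1 (sq_nonneg (v 0))]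
          simp only [map_mul, map_add, Polynomial.aeval_C, Polynomial.aeval_X, eq_ratCast]
          exact h3.ne'
        · have h3 : (0 : ℝ) < κ₀ + κ₁ * v 0 ^ 2 := by nlinarith [mul_nonneg hκ1 (sq_nonneg (v 0))]
          have hq : qD 0 0 c (v 0) = c := by simp [qD]
          rw [KZ.IntegralRep.integrand_restrict, hr₁i (hTS hv)]
          beta_reduce
          rw [ppot, snoc2_zero''', snoc2_one''', hTz v hv, ph, hc0, hq]
          simp only [map_mul, map_add, Polynomial.aeval_C, Polynomial.aeval_X, eq_ratCast]
          push_cast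
          field_simp
      · have hc' : (c : ℝ) ≤ 0 := by exact_mod_cast not_lt.1 hcp
        refine InBaker.of_mem_relations (KZ.of_mem_relations_of_eqOn_zero _ fun v hv => ?_)
        rw [KZ.IntegralRep.integrand_restrict, hr₁i (hTS hv)]
        beta_reduce
        rw [ppot, snoc2_zero''', snoc2_one''', hTz v hv, ph, hc0, Real.sqrt_eq_zero'.2 hc']
        simp
    · -- the conic wall: the primitive vanishes
      refine InBaker.of_mem_relations (KZ.of_mem_relations_of_eqOn_zero _ fun v hv => ?_)
      have hq' : (a : ℝ) * ζ v ^ 2 + c = 0 := (hTA hv).2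
      rw [KZ.IntegralRep.integrand_restrict, hr₁i (hTS hv)]
      beta_reduce
      rw [ppot, snoc2_zero''', snoc2_one''', ph, hq']
      simp
    · -- a line wall
      have hTl : ∀ v ∈ T, v ∈ S ∧ 0 < ζ v ∧
          ζ v * ((ℓ i).k1 + (ℓ i).k2 * v 0) = -(ℓ i).k0 * pN κ₀ κ₁ (v 0) := fun v hv => by
        obtain ⟨⟨hvS, hw⟩, hnz⟩ := hTA hv
        have hz : 0 < ζ v := ((hF v hvS).1).lt_of_ne fun h => hnz ⟨hvS, h.symm⟩
        exact ⟨hvS, hz, hw⟩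
      by_cases hk : (ℓ i).k0 = 0
      · -- through the centre: the vertical wall `k₁ + k₂t = 0` (null)
        have hne : ∃ x : Fin 1 → ℝ, aeval x (MvPolynomial.C (ℓ i).k1 +
            MvPolynomial.C (ℓ i).k2 * X 0 : MvPolynomial (Fin 1) ℚ) ≠ 0 := by
          rcases hℓ0 i hk with h1 | h2
          · refine ⟨fun _ => 0, ?_⟩
            simp only [map_add, map_mul, MvPolynomial.aeval_C, MvPolynomial.aeval_X, eq_ratCast,
              mul_zero, add_zero]
            exact_mod_cast h1
          · refine ⟨fun _ => ((1 - (ℓ i).k1) / (ℓ i).k2 : ℚ), ?_⟩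
            simp only [map_add, map_mul, MvPolynomial.aeval_C, MvPolynomial.aeval_X, eq_ratCast]
            have h2' : ((ℓ i).k2 : ℝ) ≠ 0 := by exact_mod_cast h2
            rw [show ((ℓ i).k1 : ℝ) + (ℓ i).k2 * (((1 - (ℓ i).k1) / (ℓ i).k2 : ℚ) : ℝ) = 1 by
              push_cast; field_simp; ring]
            exact one_ne_zero
        refine InBaker.of_subset_zeroSet _
          (MvPolynomial.C (ℓ i).k1 + MvPolynomial.C (ℓ i).k2 * X 0 : MvPolynomial (Fin 1) ℚ)
          hne fun v hv => ?_
        obtain ⟨-, hz, hw⟩ := hTl v hv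
        rw [hk] at hw
        push_cast at hw
        simp only [neg_zero, zero_mul, mul_eq_zero] at hw
        rcases hw with h | h
        · exact absurd h hz.ne'
        · simp only [map_add, map_mul, MvPolynomial.aeval_C, MvPolynomial.aeval_X, eq_ratCast]
          exact h
      · -- a line off the centre: the Euler terminal and its degenerate strata
        exact InBaker.psection_line hκ γ a c ha (ℓ i).k0 (ℓ i).k1 (ℓ i).k2 hk (S := T) ζ
          (fun v hv => ((hF v (hTl v hv).1).2 (hTl v hv).2.1).1)
          (fun v hv => ⟨(hTl v hv).2.1, ((hF v (hTl v hv).1).2 (hTl v hv).2.1).2.1⟩)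
          (fun v hv => (hTl v hv).2.2) _ subset_rfl fun v hv => by
            rw [KZ.IntegralRep.integrand_restrict, hr₁i (hTS hv)]
    · -- an adapted conic wall
      have hTw : ∀ v ∈ T, v ∈ S ∧ 0 < ζ v ∧ (a : ℝ) * ζ v ^ 2 + c =
          ((q j).k0 + ((q j).k1 + (q j).k2 * v 0) * (ζ v / pN κ₀ κ₁ (v 0))) ^ 2 := fun v hv => by
        obtain ⟨⟨hvS, hw⟩, hnz⟩ := hTA hv
        have hz : 0 < ζ v := ((hF v hvS).1).lt_of_ne fun h => hnz ⟨hvS, h.symm⟩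
        exact ⟨hvS, hz, hw⟩
      exact InBaker.psection_cwall hκ γ a c ha (q j) (hc.imp_right fun h => ⟨h.1, h.2 j⟩) (hq j)
        (S := T) ζ (hζ.mono hTS hT)
        (fun v hv => ((hF v (hTw v hv).1).2 (hTw v hv).2.1).1)
        (fun v hv => ⟨(hTw v hv).2.1, ((hF v (hTw v hv).1).2 (hTw v hv).2.1).2.1⟩)
        (fun v hv => (hTw v hv).2.2) _ subset_rfl fun v hv => by
          rw [KZ.IntegralRep.integrand_restrict, hr₁i (hTS hv)]

end Summit.KontsevichZagierPeriods.RootDecompWalshStrata.ConicDescent.BallCube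

end
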